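import Summits.FinalStateConjecture.FinalStateConjecture.Theorems.EIHFluxBalanceInertialRecessionStubIdentificationKerrScaling
import Summits.FinalStateConjecture.FinalStateConjecture.Theorems.EIHFluxBalanceInertialRecessionStubIdentificationBoost
import Literature.Geometry.Lorentzian.LandauLifshitzComplexJet

/-!
# Route EIHFluxBalance — `InertialRecession`, line `sublinear-is-free-clean-window-charges`:
# the Landau–Lifshitz four-momentum of a Kerr hole of ANY spin, at rest and boosted
# (stub `stub_identification`, part A3b)

Helper file (`--supports stmt-FinalStateConjecture-10166`) for the crux
`Summit.FinalStateConjecture.FinalStateConjecture.Theses.EIHFluxBalance.InertialRecession`.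

* `continuousOn_quasiLocalMomentum_kerr_spin` — for fixed `R > 0` the rest charge
  `b ↦ P^μ[g_{1,b}](0; 0, R)` is continuous on `|b| < R/4` (joint smoothness of the Kerr–Schild
  components in the spin and the point, `Kerr.contDiffAt_ksPert₂`, and continuity of parametric
  integrals over the compact sphere);
* `quasiLocalMomentum_kerr_rest` — **`P^μ[g_{M,a}](t; 0, R) = M δ^μ_0` for every `R > |a|`**: the
  spin rescaling `P[g_{M,a}] = P[g_{M,a/λ}]` (`…KerrScaling`) sends `a → 0` inside a continuous
  function, and the Schwarzschild value is the tree's `KSFlux.quasiLocalMomentum_schwarzschild_centre`;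
* `quasiLocalMomentum_boostedKerr_energy/_momentum` — **the boosted values `Mγ`, `Mγv^k`** on every
  lab sphere enclosing the lab trace of the rest-frame ball `{|z| ≤ |a|}`, by the spin-agnostic
  covariance theorem `quasiLocalMomentum_linChart_static`.
[cite: LandauLifshitz1975, §96 (96.16)–(96.17)]
-/

set_option linter.dupNamespace false

noncomputable section

-- instance search on the nested operator spaces `E4 →L[ℝ] E4 →L[ℝ] ℝ` is deep
set_option maxSynthPendingDepth 3

open Set Metric Filter MeasureTheory MeasureTheory.Measure Module
open scoped Topology ContDiff RealInnerProductSpace Matrix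

namespace Summit.FinalStateConjecture.FinalStateConjecture.Theorems

namespace SublinearIsFree.ChargeModel

open Literature.Geometry.Lorentzian Literature.Geometry.Lorentzian.LandauLifshitz
open LLBalance LLGauss SublinearIsFree.WindowCharges

/-! ### Joint continuity of `h[g_{1,b}](x)` in the spin and the point -/

/-- **Joint continuity of LL's `h` for the Kerr family**: `(b, x) ↦ h[g_{1,b}](x)` is continuous at
every `(b, x)` with `|b| < ‖x̃‖` (joint `C²`-smoothness of the Kerr–Schild components, the value
chain rule `h = (16π)⁻¹ Σ_β DH(g)(∂_β g)`, and continuity of the value-derivative of the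
superpotential). [cite: LandauLifshitz1975, §96 (96.2)] -/
theorem continuousAt_hField_kerr_spin {p : ℝ × E4} (hp : |p.1| < E4.spatialNorm p.2) (μ ν α : Fin 4) :
    ContinuousAt (fun q : ℝ × E4 ↦ hField (Kerr.bilin 1 q.1) q.2 μ ν α) p := by
  -- the joint field and its smoothness on the open set `W = {|b| < ‖x̃‖}`
  set F : ℝ × E4 → E4 →L[ℝ] E4 →L[ℝ] ℝ := fun q ↦ Kerr.bilin 1 q.1 q.2 with hF
  set W : Set (ℝ × E4) := {q | |q.1| < E4.spatialNorm q.2} with hW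
  have hWo : IsOpen W := isOpen_lt (continuous_abs.comp continuous_fst)
    ((E4.spatial.continuous.norm).comp continuous_snd)
  have hrad : ∀ q ∈ W, 0 < Kerr.radius q.1 q.2 := fun q hq ↦ Kerr.radius_pos_of_abs_lt hq
  have hFs : ∀ q ∈ W, ContDiffAt ℝ 2 F q := fun q hq ↦ by
    have h := (Kerr.contDiffAt_ksPert₂ (p := q) (hrad q hq) (n := 2)).add
      (contDiffAt_const (c := Minkowski.bilin))
    simpa only [sub_add_cancel] using h
  have hdet : ∀ q ∈ W, metricDet (fun _ : E4 ↦ F q) 0 ≠ 0 := fun q hq ↦ by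
    rw [show metricDet (fun _ : E4 ↦ F q) 0 = metricDet (Kerr.bilin 1 q.1) q.2 from rfl,
      show metricDet (Kerr.bilin 1 q.1) q.2 = -1 from KSMatrix.metricDet_kerr 1 q.1 (hrad q hq)]
    norm_num
  -- the value-chain-rule expression
  set Φ : ℝ × E4 → ℝ := fun q ↦ (16 * Real.pi)⁻¹ * ∑ β : Fin 4,
    fderiv ℝ (fun A : E4 →L[ℝ] E4 →L[ℝ] ℝ ↦ superpotential (fun _ : E4 ↦ A) 0 μ β ν α) (F q)
      (fderiv ℝ F q ((0 : ℝ), E4.basisVector β)) with hΦ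
  -- `h = Φ` on `W`
  have heq : ∀ q ∈ W, hField (Kerr.bilin 1 q.1) q.2 μ ν α = Φ q := by
    intro q hq
    have hslice : HasFDerivAt (fun x : E4 ↦ (q.1, x)) (ContinuousLinearMap.inr ℝ ℝ E4) q.2 :=
      hasFDerivAt_prodMk_right q.1 q.2
    have hcomp : HasFDerivAt (Kerr.bilin 1 q.1) ((fderiv ℝ F q).comp (ContinuousLinearMap.inr ℝ ℝ E4))
        q.2 := by
      have h := ((hFs q hq).differentiableAt (by norm_num)).hasFDerivAt.comp q.2 hslice
      exact h
    have hdiff : DifferentiableAt ℝ (Kerr.bilin 1 q.1) q.2 := hcomp.differentiableAt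
    have hdet' : metricDet (Kerr.bilin 1 q.1) q.2 ≠ 0 := hdet q hq
    rw [hField, hΦ]
    congr 1
    refine Finset.sum_congr rfl fun β _ ↦ ?_
    rw [partialDeriv_superpotential_eq hdiff hdet', hcomp.fderiv, ContinuousLinearMap.comp_apply,
      ContinuousLinearMap.inr_apply]
  -- `Φ` is continuous at `p`
  have hpW : p ∈ W := hp
  have hΦc : ContinuousAt Φ p := by
    refine continuousAt_const.mul (tendsto_finsetSum _ fun β _ ↦ ?_)
    have h1 : ContinuousAt (fun q ↦ fderiv ℝ (fun A : E4 →L[ℝ] E4 →L[ℝ] ℝ ↦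
        superpotential (fun _ : E4 ↦ A) 0 μ β ν α) (F q)) p :=
      (((contDiffAt_superpotential_const (hdet p hpW) μ β ν α (n := 2)).fderiv_right (m := 1)
        (by norm_num)).continuousAt).comp ((hFs p hpW).continuousAt)
    have h2 : ContinuousAt (fun q ↦ fderiv ℝ F q ((0 : ℝ), E4.basisVector β)) p :=
      (((hFs p hpW).fderiv_right (m := 1) (by norm_num)).continuousAt).clm_apply continuousAt_const
    exact h1.clm_apply h2
  exact hΦc.congr_of_eventuallyEq (Filter.eventually_of_mem (hWo.mem_nhds hpW) fun q hq ↦ heq q hq)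

/-! ### Continuity of the rest charge in the spin -/

/-- A continuous cutoff of `E3` vanishing on the ball of radius `R/3` and equal to `1` outside the
ball of radius `R/2`. [folklore] -/
theorem exists_continuous_cutoff_annulus {R : ℝ} (hR : 0 < R) :
    ∃ χ : E3 → ℝ, Continuous χ ∧ (∀ y, ‖y‖ ≤ R / 3 → χ y = 0) ∧ ∀ y, R / 2 ≤ ‖y‖ → χ y = 1 := by
  refine ⟨fun y ↦ min 1 (max 0 ((‖y‖ - R / 3) / (R / 6))), ?_, fun y hy ↦ ?_, fun y hy ↦ ?_⟩
  · exact continuous_const.min (continuous_const.max ((continuous_norm.sub continuous_const).div_const _))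
  · have h : (‖y‖ - R / 3) / (R / 6) ≤ 0 := div_nonpos_of_nonpos_of_nonneg (by linarith) (by positivity)
    show min 1 (max 0 ((‖y‖ - R / 3) / (R / 6))) = 0
    rw [max_eq_left h, min_eq_right zero_le_one]
  · have h : 1 ≤ (‖y‖ - R / 3) / (R / 6) := by
      rw [le_div_iff₀ (by positivity)]
      linarith
    show min 1 (max 0 ((‖y‖ - R / 3) / (R / 6))) = 1
    rw [min_eq_left (h.trans (le_max_right _ _))]

/-- **The rest charge of the Kerr family is continuous in the spin**: for `R > 0`,
`b ↦ P^μ[g_{1,b}](0; 0, R)` is continuous on `{|b| < R/4}` (continuity of the parametric integral of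
the jointly continuous momentum density over the compact sphere, after a cutoff near the origin).
[cite: LandauLifshitz1975, §96 (96.16)] -/
theorem continuousOn_quasiLocalMomentum_kerr_spin {R : ℝ} (hR : 0 < R) (μ : Fin 4) :
    ContinuousOn (fun b : ℝ ↦ quasiLocalMomentum (Kerr.bilin 1 b) 0 0 R μ) (Ioo (-(R / 4)) (R / 4)) := by
  obtain ⟨χ, hχc, hχ0, hχ1⟩ := exists_continuous_cutoff_annulus hR
  set X : Set ℝ := Ioo (-(R / 4)) (R / 4) with hX
  haveI : LocallyCompactSpace X := isOpen_Ioo.locallyCompactSpace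
  haveI : IsFiniteMeasure ((μHE[2] : Measure E3).restrict (sphere (0 : E3) R)) :=
    ⟨by rw [Measure.restrict_apply_univ]; exact LandauLifshitz.euclideanHausdorff_sphere_lt_top 0 R⟩
  -- the modified integrand, jointly continuous on `X × E3`
  set f : X → E3 → ℝ := fun b y ↦ χ y * ∑ j : Fin 3,
    hField (Kerr.bilin 1 (b : ℝ)) (E4.ofTimeSpace 0 y) μ 0 j.succ * (y - 0) j / R with hf
  have hfc : Continuous f.uncurry := by
    refine continuous_iff_continuousAt.2 fun q ↦ ?_
    by_cases hq : R / 4 < ‖q.2‖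
    · -- honest continuity: `|b| < R/4 < ‖y‖`
      have hemb : Continuous fun q' : X × E3 ↦ (((q'.1 : X) : ℝ), E4.ofTimeSpace 0 q'.2) :=
        (continuous_subtype_val.comp continuous_fst).prodMk
          ((E4.continuous_ofTimeSpace 0).comp continuous_snd)
      have hp : |(((q.1 : X) : ℝ), E4.ofTimeSpace 0 q.2).1| <
          E4.spatialNorm (((q.1 : X) : ℝ), E4.ofTimeSpace 0 q.2).2 := by
        rw [E4.spatialNorm_ofTimeSpace]
        exact (abs_lt.2 q.1.2).trans hq
      have hh : ∀ j : Fin 3, ContinuousAt ((fun p' : ℝ × E4 ↦ hField (Kerr.bilin 1 p'.1) p'.2 μ 0 j.succ) ∘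
          fun q' : X × E3 ↦ (((q'.1 : X) : ℝ), E4.ofTimeSpace 0 q'.2)) q := fun j ↦
        ContinuousAt.comp_of_eq (g := fun p' : ℝ × E4 ↦ hField (Kerr.bilin 1 p'.1) p'.2 μ 0 j.succ)
          (f := fun q' : X × E3 ↦ (((q'.1 : X) : ℝ), E4.ofTimeSpace 0 q'.2))
          (continuousAt_hField_kerr_spin hp μ 0 j.succ) hemb.continuousAt rfl
      have hcoord : ∀ j : Fin 3, Continuous fun q' : X × E3 ↦ (q'.2 - 0) j := fun j ↦
        ((continuous_apply j).comp (PiLp.continuous_ofLp 2 _)).comp (continuous_snd.sub continuous_const)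
      exact (hχc.continuousAt.comp continuous_snd.continuousAt).mul
        (tendsto_finsetSum _ fun j _ ↦ ((hh j).mul (hcoord j).continuousAt).div_const _)
    · -- near `q` the cutoff vanishes
      rw [not_lt] at hq
      have hzero : f.uncurry =ᶠ[𝓝 q] fun _ ↦ 0 := by
        have hball : ∀ᶠ q' : X × E3 in 𝓝 q, ‖q'.2‖ < R / 3 :=
          (continuous_snd.norm.tendsto q) (Iio_mem_nhds (by simpa using hq.trans_lt (by linarith)))
        filter_upwards [hball] with q' hq'
        show χ q'.2 * _ = 0
        rw [hχ0 _ hq'.le, zero_mul]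
      exact continuousAt_const.congr_of_eventuallyEq hzero
  -- continuity of the parametric integral over the compact sphere
  have hcont : Continuous fun b : X ↦ ∫ y in sphere (0 : E3) R, f b y
      ∂((μHE[2] : Measure E3).restrict (sphere (0 : E3) R)) :=
    continuous_parametric_integral_of_continuous hfc (isCompact_sphere 0 R)
  -- it is the rest charge
  have heq : ∀ b : X, ∫ y in sphere (0 : E3) R, f b y ∂((μHE[2] : Measure E3).restrict (sphere (0 : E3) R)) =
      quasiLocalMomentum (Kerr.bilin 1 (b : ℝ)) 0 0 R μ := by
    intro b
    rw [Measure.restrict_restrict isClosed_sphere.measurableSet, inter_self, quasiLocalMomentum]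
    refine setIntegral_congr_fun isClosed_sphere.measurableSet fun y hy ↦ ?_
    have hy' : R / 2 ≤ ‖y‖ := by
      rw [mem_sphere, dist_zero_right] at hy
      rw [hy]
      linarith
    show χ y * _ = _
    rw [hχ1 y hy', one_mul]
  rw [continuousOn_iff_continuous_restrict]
  exact hcont.congr fun b ↦ heq b

/-! ### The rest charge of a Kerr hole -/

/-- **The Landau–Lifshitz four-momentum of a Kerr hole at rest is `(M, 0, 0, 0)` on every centred
coordinate sphere enclosing the ring**: `P^μ[g_{M,a}](t; 0, R) = M δ^μ_0` for `R > |a|`. Proof: by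
conservation (`KSFlux.hasDerivAt_quasiLocalMomentum_kerr`) take `t = 0`; by `…kerr_spin_rescale`
`P[g_{M,a}] = P[g_{M,a/λ}]` for all `λ ≥ 1`; `λ → ∞` inside the continuous rest charge lands on the
Schwarzschild value `KSFlux.quasiLocalMomentum_schwarzschild_centre`.
[cite: LandauLifshitz1975, §96 (96.16)] -/
theorem quasiLocalMomentum_kerr_rest (M a : ℝ) {R : ℝ} (haR : |a| < R) (μ : Fin 4) :
    quasiLocalMomentum (Kerr.bilin M a) 0 0 R μ = if μ = 0 then M else 0 := by
  have hR : 0 < R := (abs_nonneg a).trans_lt haR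
  rw [quasiLocalMomentum_kerr_mass M a haR, ← KSFlux.quasiLocalMomentum_schwarzschild_centre M 0 hR μ,
    quasiLocalMomentum_kerr_mass M 0 (by rwa [abs_zero]) 0 μ]
  congr 1
  -- `P[g_{1,a}](R) = P[g_{1,a/λ}](R)` for all `λ ≥ 1`, and `a/λ → 0` inside the continuous charge
  have hconst : ∀ lam : ℝ, 1 ≤ lam → quasiLocalMomentum (Kerr.bilin 1 (a / lam)) 0 0 R μ =
      quasiLocalMomentum (Kerr.bilin 1 a) 0 0 R μ := fun lam hlam ↦
    (quasiLocalMomentum_kerr_spin_rescale 1 a haR hlam μ).symm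
  have hlim : Tendsto (fun lam : ℝ ↦ quasiLocalMomentum (Kerr.bilin 1 (a / lam)) 0 0 R μ) atTop
      (𝓝 (quasiLocalMomentum (Kerr.bilin 1 0) 0 0 R μ)) := by
    have hc := (continuousOn_quasiLocalMomentum_kerr_spin hR μ).continuousAt
      (Ioo_mem_nhds (by linarith) (by linarith) : Ioo (-(R / 4)) (R / 4) ∈ 𝓝 (0 : ℝ))
    have hdiv : Tendsto (fun lam : ℝ ↦ a / lam) atTop (𝓝 0) := tendsto_id.const_div_atTop a
    exact hc.tendsto.comp hdiv
  have hlim' : Tendsto (fun lam : ℝ ↦ quasiLocalMomentum (Kerr.bilin 1 (a / lam)) 0 0 R μ) atTop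
      (𝓝 (quasiLocalMomentum (Kerr.bilin 1 a) 0 0 R μ)) :=
    tendsto_const_nhds.congr' (Filter.eventually_atTop.2 ⟨1, fun lam hlam ↦ (hconst lam hlam).symm⟩)
  exact (tendsto_nhds_unique hlim' hlim)

/-- The same at every time `t` (the rest charge is conserved, indeed the components are stationary).
[cite: LandauLifshitz1975, §96 (96.16)] -/
theorem quasiLocalMomentum_kerr_rest_time (M a t : ℝ) {R : ℝ} (haR : |a| < R) (μ : Fin 4) :
    quasiLocalMomentum (Kerr.bilin M a) t 0 R μ = if μ = 0 then M else 0 := by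
  have h := KSCharge.quasiLocalMomentum_comp_sub (Kerr.bilin M a) (t • E4.basisVector 0) t 0 R μ
  have hstat : (fun z ↦ Kerr.bilin M a (z - t • E4.basisVector 0)) = Kerr.bilin M a := by
    funext z
    rw [sub_eq_add_neg, ← neg_smul, Kerr.bilin_add_smul_basisVector_zero]
  have hsp : E4.spatial (t • E4.basisVector 0) = 0 := by
    ext i
    simp
  rw [hstat, hsp, sub_zero, PiLp.smul_apply, smul_eq_mul] at h
  simp only [PiLp.single_apply, if_true, mul_one, sub_self] at h
  rw [h]
  exact quasiLocalMomentum_kerr_rest M a haR μ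

/-! ### The four-momentum of a boosted Kerr hole of any spin -/

/-- **The Landau–Lifshitz four-momentum of a boosted Kerr hole of any spin** (raw form): for
`Λ ∈ O(1,3)`, `c ∈ E4`, `u = Λe₀`, and every lab sphere `{x⁰ = t, |y − ξ| = R}` enclosing the lab trace
`{y : |(Λ⁻¹((t, y) − c))~| ≤ |a|}` of the rest-frame ball around the ring at lab time `t`,
`P^μ[boostedKerrBilin Λ c M a](t; ξ, R) = M |u⁰|⁻¹ u⁰ u^μ` (covariance `quasiLocalMomentum_linChart_static`
with `K = closedBall 0 |a|` and the rest charge `quasiLocalMomentum_kerr_rest`).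
[cite: LandauLifshitz1975, §96 (96.16)–(96.17)] -/
theorem quasiLocalMomentum_boostedKerr (Λ : lorentzGroup) (c : E4) (M a : ℝ) {t : ℝ} {ξ : E3}
    {R : ℝ} (hR : 0 < R)
    (hencl : ∀ y : E3, ‖E4.spatial (poincareInv Λ c (E4.ofTimeSpace t y))‖ ≤ |a| → y ∈ ball ξ R)
    (μ : Fin 4) :
    quasiLocalMomentum (boostedKerrBilin Λ c M a) t ξ R μ =
      M * |((Λ : E4 ≃L[ℝ] E4) (E4.basisVector 0)) 0|⁻¹ * ((Λ : E4 ≃L[ℝ] E4) (E4.basisVector 0)) 0 *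
        ((Λ : E4 ≃L[ℝ] E4) (E4.basisVector 0)) μ := by
  -- Step T: remove the translation
  have htr : boostedKerrBilin Λ c M a = fun z ↦ boostedKerrBilin Λ 0 M a (z - c) := by
    funext z
    ext v w
    simp only [boostedKerrBilin_apply, poincareInv, sub_zero]
  rw [htr, KSCharge.quasiLocalMomentum_comp_sub]
  -- Step C: the covariance theorem for `L = Λ⁻¹`, `K = {0}`, `ρ = 1`
  have hrad : ∀ x : E4, E4.spatial x ∉ closedBall (0 : E3) |a| → 0 < Kerr.radius a x := fun x hx ↦ by
    refine Kerr.radius_pos_of_abs_lt ?_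
    rw [mem_closedBall, dist_zero_right, not_le] at hx
    exact hx
  have hreg : ∀ x : E4, E4.spatial x ∉ closedBall (0 : E3) |a| → x ∈ Kerr.region a 0 := fun x hx ↦ by
    rw [Kerr.mem_region, max_self]
    exact hrad x hx
  have hpi : ∀ x : E4, poincareInv Λ 0 x = (Λ : E4 ≃L[ℝ] E4).symm x := fun x ↦ by rw [poincareInv, sub_zero]
  have hg' : ∀ x v w : E4, boostedKerrBilin Λ 0 M a x v w =
      Kerr.bilin M a ((Λ : E4 ≃L[ℝ] E4).symm x) ((Λ : E4 ≃L[ℝ] E4).symm v) ((Λ : E4 ≃L[ℝ] E4).symm w) := fun x v w ↦ by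
    rw [boostedKerrBilin_apply, hpi]
  have hg : ContDiffOn ℝ ∞ (Kerr.bilin M a) {x : E4 | E4.spatial x ∉ closedBall (0 : E3) |a|} :=
    fun x hx ↦ (Kerr.contDiffAt_bilin M a (hrad x hx)).contDiffWithinAt
  have hdet : ∀ x : E4, E4.spatial x ∉ closedBall (0 : E3) |a| → metricDet (Kerr.bilin M a) x ≠ 0 :=
    fun x hx ↦ by
      rw [show metricDet (Kerr.bilin M a) x = -1 from KSMatrix.metricDet_kerr M a (hrad x hx)]
      norm_num
  have hem : ∀ x : E4, E4.spatial x ∉ closedBall (0 : E3) |a| → ∀ μ ν, emComplex (Kerr.bilin M a) x μ ν = 0 :=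
    fun x hx μ ν ↦ KSFlux.emComplex_kerr_eq_zero M a 0 (hreg x hx) μ ν
  have hg'c : ContDiffOn ℝ ∞ (boostedKerrBilin Λ 0 M a)
      {x : E4 | E4.spatial ((Λ : E4 ≃L[ℝ] E4).symm x) ∉ closedBall (0 : E3) |a|} := fun x hx ↦
    (contDiffAt_boostedKerrBilin Λ 0 M a (by rw [hpi]; exact hrad _ hx)).contDiffWithinAt
  have hem' : ∀ x : E4, E4.spatial ((Λ : E4 ≃L[ℝ] E4).symm x) ∉ closedBall (0 : E3) |a| → ∀ μ,
      emComplex (boostedKerrBilin Λ 0 M a) x μ 0 = 0 := fun x hx μ ↦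
    KSFlux.emComplex_boostedKerr_eq_zero Λ 0 M a 0 (by
      show poincareInv Λ 0 x ∈ (Kerr.region a 0 : Set E4)
      rw [hpi]
      exact hreg _ hx) μ 0
  have hKin : ∀ y : E3, E4.spatial ((Λ : E4 ≃L[ℝ] E4).symm (E4.ofTimeSpace (t - c 0) y)) ∈
      closedBall (0 : E3) |a| → y ∈ ball (ξ - E4.spatial c) R := by
    intro y hy
    have h := hencl (y + E4.spatial c) (by
      rw [poincareInv, KSCharge.ofTimeSpace_sub, add_sub_cancel_right]
      rw [mem_closedBall, dist_zero_right] at hy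
      exact hy)
    rw [mem_ball, dist_eq_norm] at h ⊢
    rwa [show y - (ξ - E4.spatial c) = y + E4.spatial c - ξ by abel]
  have hcov := quasiLocalMomentum_linChart_static (g := Kerr.bilin M a) (g' := boostedKerrBilin Λ 0 M a)
    (Λ : E4 ≃L[ℝ] E4).symm hg' (isCompact_closedBall 0 |a|) hg hdet hem
    (Kerr.bilin_add_smul_basisVector_zero M a) hg'c hem' (injective_spatial_lorentz_symm_slice Λ) hR hKin
    (by positivity : (0 : ℝ) < |a| + 1) (closedBall_subset_ball (by linarith)) μ
  rw [hcov]
  -- Step V: evaluate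
  simp only [ContinuousLinearEquiv.symm_symm, quasiLocalMomentum_kerr_rest M a
    (by linarith [abs_nonneg a] : |a| < |a| + 1), mul_ite, mul_zero, Finset.sum_ite_eq', Finset.mem_univ,
    if_true]
  -- the spatial block: `|det A| = |u⁰|`
  set P : Matrix (Fin 4) (Fin 4) ℝ :=
    Matrix.of fun i j : Fin 4 ↦ (((Λ : E4 ≃L[ℝ] E4).symm : E4 →L[ℝ] E4) (E4.basisVector j)) i with hP
  have hPdet : P.det ^ 2 = 1 := det_sq_lorentz_symm Λ
  have hPdet0 : P.det ≠ 0 := fun h ↦ by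
    rw [h] at hPdet
    norm_num at hPdet
  have hQ : (Matrix.of fun i j : Fin 4 ↦ (((Λ : E4 ≃L[ℝ] E4) : E4 →L[ℝ] E4) (E4.basisVector j)) i) = P⁻¹ := by
    have h := linChartMatrix_symm_eq_inv (Λ : E4 ≃L[ℝ] E4).symm
    rw [ContinuousLinearEquiv.symm_symm] at h
    exact h
  have hA : (Matrix.of fun m j : Fin 3 ↦ ((Λ : E4 ≃L[ℝ] E4).symm (E4.basisVector j.succ)) m.succ) =
      P.submatrix Fin.succ Fin.succ := by
    ext m j
    rfl
  have hu0 : ((Λ : E4 ≃L[ℝ] E4) (E4.basisVector 0)) 0 = P⁻¹ 0 0 := by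
    rw [← hQ, Matrix.of_apply]
    rfl
  have habs : |(Matrix.of fun m j : Fin 3 ↦ ((Λ : E4 ≃L[ℝ] E4).symm (E4.basisVector j.succ)) m.succ).det| =
      |((Λ : E4 ≃L[ℝ] E4) (E4.basisVector 0)) 0| := by
    rw [hA, ← inv_zero_zero_mul_det P hPdet0, abs_mul, ← hu0]
    have h1 : |P.det| = 1 := by
      have h2 : |P.det| ^ 2 = 1 := by rw [sq_abs, hPdet]
      nlinarith [abs_nonneg P.det]
    rw [h1, mul_one]
  rw [habs, hPdet]
  simp only [Matrix.of_apply, ContinuousLinearEquiv.coe_coe]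
  ring


/-- **The quasi-local energy of a boosted Kerr hole is `Mγ`** on every lab sphere enclosing the lab
trace of the rest-frame ball `{|z| ≤ |a|}`: `P^0[boostedKerrBilin Λ c M a](t; ξ, R) = M (1 − |v|²)^{-1/2}`,
`v = (Λe₀)~/(Λe₀)⁰`. [cite: LandauLifshitz1975, §96 (96.16)–(96.17)] -/
theorem quasiLocalMomentum_boostedKerr_energy (Λ : lorentzGroup) (c : E4) (M a : ℝ) {t : ℝ}
    {ξ : E3} {R : ℝ} (hR : 0 < R)
    (hencl : ∀ y : E3, ‖E4.spatial (poincareInv Λ c (E4.ofTimeSpace t y))‖ ≤ |a| → y ∈ ball ξ R) :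
    quasiLocalMomentum (boostedKerrBilin Λ c M a) t ξ R 0 =
      M * (√(1 - ‖(((Λ : E4 ≃L[ℝ] E4) (E4.basisVector 0)) 0)⁻¹ •
        E4.spatial ((Λ : E4 ≃L[ℝ] E4) (E4.basisVector 0))‖ ^ 2))⁻¹ := by
  rw [quasiLocalMomentum_boostedKerr Λ c M a hR hencl 0, ← abs_lorentz_apply_zero_eq_gamma]
  set u0 : ℝ := ((Λ : E4 ≃L[ℝ] E4) (E4.basisVector 0)) 0 with hu0
  have ha : |u0| ≠ 0 := abs_ne_zero.2 fun h ↦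
    absurd (one_le_abs_lorentz_apply_zero Λ) (by rw [← hu0, h, abs_zero]; norm_num)
  calc M * |u0|⁻¹ * u0 * u0 = M * (|u0|⁻¹ * (|u0| * |u0|)) := by
        rw [abs_mul_abs_self]
        ring
    _ = M * |u0| := by rw [inv_mul_cancel_left₀ ha]

/-- **The quasi-local momentum of a boosted Kerr hole is `Mγv`** on every lab sphere enclosing the
lab trace of the rest-frame ball `{|z| ≤ |a|}`: `P^k[boostedKerrBilin Λ c M a](t; ξ, R) = M (1 − |v|²)^{-1/2} v^k`,
`v = (Λe₀)~/(Λe₀)⁰`. [cite: LandauLifshitz1975, §96 (96.16)–(96.17)] -/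
theorem quasiLocalMomentum_boostedKerr_momentum (Λ : lorentzGroup) (c : E4) (M a : ℝ)
    {t : ℝ} {ξ : E3} {R : ℝ} (hR : 0 < R)
    (hencl : ∀ y : E3, ‖E4.spatial (poincareInv Λ c (E4.ofTimeSpace t y))‖ ≤ |a| → y ∈ ball ξ R)
    (k : Fin 3) :
    quasiLocalMomentum (boostedKerrBilin Λ c M a) t ξ R k.succ =
      M * (√(1 - ‖(((Λ : E4 ≃L[ℝ] E4) (E4.basisVector 0)) 0)⁻¹ •
        E4.spatial ((Λ : E4 ≃L[ℝ] E4) (E4.basisVector 0))‖ ^ 2))⁻¹ *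
        ((((Λ : E4 ≃L[ℝ] E4) (E4.basisVector 0)) 0)⁻¹ •
          E4.spatial ((Λ : E4 ≃L[ℝ] E4) (E4.basisVector 0))) k := by
  rw [quasiLocalMomentum_boostedKerr Λ c M a hR hencl k.succ,
    ← abs_lorentz_apply_zero_eq_gamma, PiLp.smul_apply, smul_eq_mul, E4.spatial_apply]
  set u0 : ℝ := ((Λ : E4 ≃L[ℝ] E4) (E4.basisVector 0)) 0 with hu0
  have h0 : u0 ≠ 0 := fun h ↦
    absurd (one_le_abs_lorentz_apply_zero Λ) (by rw [← hu0, h, abs_zero]; norm_num)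
  have key : |u0|⁻¹ * u0 = |u0| * u0⁻¹ := by
    field_simp
    rw [sq_abs]
  calc M * |u0|⁻¹ * u0 * ((Λ : E4 ≃L[ℝ] E4) (E4.basisVector 0)) k.succ
      = M * (|u0|⁻¹ * u0) * ((Λ : E4 ≃L[ℝ] E4) (E4.basisVector 0)) k.succ := by ring
    _ = M * |u0| * (u0⁻¹ * ((Λ : E4 ≃L[ℝ] E4) (E4.basisVector 0)) k.succ) := by
      rw [key]
      ring

end SublinearIsFree.ChargeModel

/-- Registered sub-goal form (stub `ll_kerr_rest_charge` of the crux item) of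
`SublinearIsFree.ChargeModel.quasiLocalMomentum_kerr_rest`: the LL four-momentum of a Kerr hole at
rest is `(M, 0, 0, 0)` on every centred sphere enclosing the ring. [cite: LandauLifshitz1975, §96 (96.16)] -/
theorem ll_kerr_rest_charge : open Literature.Geometry.Lorentzian in ∀ (M a : ℝ) {R : ℝ}, |a| < R → ∀ μ : Fin 4, LandauLifshitz.quasiLocalMomentum (Kerr.bilin M a) 0 0 R μ = if μ = 0 then M else 0 :=
  fun M a _R haR μ ↦ SublinearIsFree.ChargeModel.quasiLocalMomentum_kerr_rest M a haR μ

/-- Registered sub-goal form (stub `ll_boostedKerr_energy` of the crux item) of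
`SublinearIsFree.ChargeModel.quasiLocalMomentum_boostedKerr_energy`: the LL energy of a boosted Kerr
hole of any spin on every enclosing lab sphere is `Mγ`. [cite: LandauLifshitz1975, §96 (96.16)–(96.17)] -/
theorem ll_boostedKerr_energy : open Literature.Geometry.Lorentzian Metric in ∀ (Λ : lorentzGroup) (c : E4) (M a : ℝ) {t : ℝ} {ξ : E3} {R : ℝ}, 0 < R → (∀ y : E3, ‖E4.spatial (poincareInv Λ c (E4.ofTimeSpace t y))‖ ≤ |a| → y ∈ ball ξ R) → LandauLifshitz.quasiLocalMomentum (boostedKerrBilin Λ c M a) t ξ R 0 = M * (√(1 - ‖(((Λ : E4 ≃L[ℝ] E4) (E4.basisVector 0)) 0)⁻¹ • E4.spatial ((Λ : E4 ≃L[ℝ] E4) (E4.basisVector 0))‖ ^ 2))⁻¹ :=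
  fun Λ c M a _t _ξ _R hR hencl ↦
    SublinearIsFree.ChargeModel.quasiLocalMomentum_boostedKerr_energy Λ c M a hR hencl

/-- Registered sub-goal form (stub `ll_boostedKerr_momentum` of the crux item) of
`SublinearIsFree.ChargeModel.quasiLocalMomentum_boostedKerr_momentum`: the LL momentum of a boosted
Kerr hole of any spin on every enclosing lab sphere is `Mγv`. [cite: LandauLifshitz1975, §96 (96.16)–(96.17)] -/
theorem ll_boostedKerr_momentum : open Literature.Geometry.Lorentzian Metric in ∀ (Λ : lorentzGroup) (c : E4) (M a : ℝ) {t : ℝ} {ξ : E3} {R : ℝ}, 0 < R → (∀ y : E3, ‖E4.spatial (poincareInv Λ c (E4.ofTimeSpace t y))‖ ≤ |a| → y ∈ ball ξ R) → ∀ k : Fin 3, LandauLifshitz.quasiLocalMomentum (boostedKerrBilin Λ c M a) t ξ R k.succ = M * (√(1 - ‖(((Λ : E4 ≃L[ℝ] E4) (E4.basisVector 0)) 0)⁻¹ • E4.spatial ((Λ : E4 ≃L[ℝ] E4) (E4.basisVector 0))‖ ^ 2))⁻¹ * ((((Λ : E4 ≃L[ℝ] E4) (E4.basisVector 0)) 0)⁻¹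 • E4.spatial ((Λ : E4 ≃L[ℝ] E4) (E4.basisVector 0))) k :=
  fun Λ c M a _t _ξ _R hR hencl k ↦
    SublinearIsFree.ChargeModel.quasiLocalMomentum_boostedKerr_momentum Λ c M a hR hencl k

end Summit.FinalStateConjecture.FinalStateConjecture.Theorems

end
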